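import Literature.MathematicalPhysics.QuantumFieldTheory.Balaban1983to89.B1Prop21ZeroField
import Literature.MathematicalPhysics.QuantumFieldTheory.Balaban1983to89.B4ThmTorusPairEta
import Literature.MathematicalPhysics.QuantumFieldTheory.Balaban1983to89.B4Eq12ExpFlow

/-!
# `Balaban1983to89.B1Prop21RegularFieldFams` — T. Bałaban, *(Higgs)₂,₃ quantum fields in a finite volume. I. A lower bound*,
# Commun. Math. Phys. **85** (1982) 603–626 [Balaban1982Higgs1]: **Proposition 2.1** (2.23)–(2.26) pp. 610–611 AT A REGULAR FIELD
# `A ≠ 0` — the ruled reading (Hölder range `0 ≦ α < 1`) HOLDS on the two families of [Balaban1983RegularityDecay]'s Theorem p. 573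
# at a (1.7)-regular vector field: r01's `B4ThmRegionPairEta.regionPairFam` (general pairs `Ω ⊂ Ω₀` of finite unions of big blocks in
# `ηℤ^{d+1}`, the restriction `dist(·, Ω^c) ≧ R₀` live) and r01's `B4TorusPairFam.torusPairFam` (`Ω ⊂ Ω₀ ⊂ T_η`), by p14's kernel bridge
# Prop. I.2.1 ≡ B4's Theorem p. 573; also for the printed link variables `U(A) = e^{qeηA}` (every antisymmetric `q`); theorems only

statement-level skeleton of published theorems with citation tags; proofs where landed; nothing here is a claim about the Yang–Mills mass gap

PDF held: `paper:balaban1982-cmp85-higgs23-i` (journal page = PDF page + 602), pp. 610–611 [PDF 8–9] (Prop. 2.1; ×2 renders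
`run/shared/lean/pub/pub-balaban/b2b-balaban-ref1/pages/1982-cmp85-higgs23-I/1982-cmp85-higgs23-I-p008|p009-x2.png`); companion
`paper:balaban1983-cmp89-regularity-decay` (journal page = PDF page + 570), p. 572 [PDF 2] ((1.2) the link variables, (1.7) regularity, the
torus), p. 573 [PDF 3] (the Theorem *"(Proposition 2.1 of [1])"*) — both pages re-read by this seat (`lit read … --pages 2-3`).

CITATION HEADER (lean-in-tree rule).  Cell `lit-balaban` (HOME `run/shared/lean/pub/lit-balaban/`), Phase-2 proof seat **p35** gen 11 (unit
`lit-balaban-p35`); SKELETON row **B1.Prop2.1** (decl of record `…B1.Prop21Printed`, pv07, UNCHANGED; fold owners r01/r14, referee ref-4), xref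
row B4.Thm@573; kind «knitting» (the B4 sub-cell's regular-field ledger of the Theorem p. 573 transported through pv07's bridge).  EVERYTHING
MATHEMATICAL BELOW IS AN EXISTING KERNEL THEOREM OF THE TREE, USED BY NAME: p14 gen 8's `B1Prop21ZeroField.prop21NN_iff_thmPrintedNN` (the
ruled reading of Prop. 2.1, written out over the typed displays `B1.Ineq224_225`/`B1.Ineq226`, IS `B4Ineq111ZeroNestEta.ThmPrintedNN`), r01
gen 8's `B4ThmRegionPairEta.thmPrintedNN_regionPairFam` (B4's Theorem p. 573 (1.9)–(1.12) in pv17's typed `η`-uniform form on the family of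
general pairs `Ω ⊂ Ω₀` of finite unions of big blocks of `ηℤ^{d+1}` at a (1.7)-regular field, `rect := False`), r01 gen 9's
`B4ThmTorusPairEta.thmPrintedNN_torusPairFam` (the same on the family of torus region pairs `Ω ⊂ Ω₀ ⊂ T_η`, proposal p318600), their
non-vacuity theorems `hypotheses_met`, and r01's `B4Eq12ExpFlow.expFlow_lipschitz` (the printed flow `U(t) = e^{tq}` meets the flow hypothesis
of the two theorems).  Gens 8–10 of this seat proved the three clauses of Prop. 2.1 WITH their decay factors for the (Higgs)₂,₃ carrier's own
operators `HiggsCovariance.propagatorK` at the regular background `A^{(K),ε}` on `Ω = T_ε` (`B1Ineq225DecayBackgroundTorus`,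
`B1Ineq225DerivDecayBackgroundTorus`, `B1Ineq224BackgroundTorus`); this file books the typed leaf itself at `A ≠ 0`.

WHAT IS PRINTED (v1.1: quotation corrected to the letter of the ×2 renders p008/p009 — v1 of this header paraphrased (2.23), the
big-block sentence and the (2.26) factor inside quotation marks; no declaration changed).  I p. 610 [PDF 8], verbatim: *"**Proposition 2.1.**
Let a set Ω satisfies Ω = B^k(Ω^{(k)}) and let Ω^{(k)} ⊂ T₁^{(k)} be a sum of big blocks with M sufficiently large. Further, let a
configuration A be regular on Ω in the sense that |(∂^η_μA)(x)| ≦ c(e(L^kε))^{β−1}, x ∈ Ω, μ = 1,…,d, (2.23) where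
e(L^kε) = e(L^kε)^{(4−d)/2}, η = L^{−k}, β > 0 and c is some universal constant. For an arbitrary pair of points x, x′ ∈ T_η let us denote
yb [sic] Γ_{x,x′} a shortest contour connecting these points. Then for e(L^kε) sufficiently small and α < 1 there exist positive constants
δ₀, c₀, R₀ independent of A, k, Ω and depending on d, a, M only, c₀ on α also, such that for an arbitrary function f : Ω → R^N we have
(1/|x − x′|^α)|U(A(Γ_{x,x′}))(D^η_{A,μ}G_k(Ω, A)f)(x′) − (D^η_{A,μ}G_k(Ω, A)f)(x)| ≦ c₀ exp(−δ₀ dist({x, x′}, supp f))‖f‖_∞ (2.24) for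
x, x′ ∈ Ω and satisfying the condition dist({x, x′}, Ω^c) ≧ R₀. Similarly we have |(D^η_{A,μ}G_k(Ω, A)f)(x)|, |(G_k(Ω, A)f)(x)| ≦
c₀ exp(−δ₀ dist(x, supp f))‖f‖_∞ (2.25) for x ∈ Ω, dist(x, Ω^c) ≧ R₀. If Ω ⊂ Ω₀, then for δG_k(Ω, Ω₀, A) defined by the equality
δG_k(Ω, Ω₀, A) = G_k(Ω, A) − G_k(Ω₀, A), (2.26) we have the inequalities (2.24), (2.25) with the additional factor
exp(−δ₀ dist(supp f, Ω^c) − δ₀ dist({x, x′}, Ω^c))"* — continued on p. 611 [PDF 9], verbatim: *"on the right sides. For some simple sets Ω,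
e.g. for rectangular parallelepipeds, the inequalities hold without any restrictions on the points x, x′, i.e. for all x, x′ ∈ Ω. Let us
notice that Ω^c means a complement in T_η, so in the case Ω = T_η the condition dist({x, x′}, Ω^c) ≧ R₀ is meaningless and is omitted."*
(the displays are typed in pv07's `B1.Ineq224_225`/`B1.Ineq226`, whose docstrings record the reading of the printed «Ω^c» in the (2.26) factor
against [Balaban1983RegularityDecay] (1.12)); p. 610 above the proposition, verbatim: *"In the sequel the properties of the propagator
G^ε_k(Ω, A) rescaled to the η-lattice, η = L^{−k}, will be very important. Let us notice that the rescaled propagator is given by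
G_k(Ω, A) = (−Δ^{η,N}_{A,Ω} + m²(L^kε)² + a_kP_k(A))^{−1}. (2.22)"*.  B4 p. 572 [PDF 2], verbatim: *"The operators we are going to define
depend on A through the function U(A) = e^{qeηA}, q is an antisymmetric N × N matrix, where e is a real parameter. (1.2)"*, *"Another
common case is to consider operators on subsets of a torus T_η which we identify with a rectangular parallelepiped in ηZ^d with periodic
conditions."*, *"We consider subsets Ω which are unions of big blocks."*, *"We consider all these operators under the assumption that the
vector field A is regular on Ω in the sense that"* [(1.7)]; p. 573 [PDF 3], verbatim: *"Theorem (Proposition 2.1 of [1])."*.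

WHAT THIS FILE PROVES (kernel-checked, zero `sorry`, NO `def`; axioms standard).
* **`prop21NN_regionPairFam`** — for every orthogonal one-parameter flow `U` with `|(U(t) − 1)v|² ≦ (ℓ₁t)²|v|²`, `d + 1 ≧ 1` dimensions,
  `L = ℓ + 1 ≧ 2`, windows `0 < a₋ ≦ a ≦ a₊`, `0 ≦ m² ≦ m²₊`, (1.7)-constants `c ≧ 0`, `β > 0`: the ruled reading of Prop. 2.1 (the typed leaf
  `B1.Prop21Printed` with the binder `0 ≦ α` inserted: for every `0 ≦ α < 1` there are `δ₀, c₀, R₀, e₁ > 0` with (2.24)–(2.25) `B1.Ineq224_225` and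
  (2.26) `B1.Ineq226` for every member whose field is regular, whose regions are big-block unions and whose coupling is `0 < e ≦ e₁`) HOLDS on
  `regionPairFam U d ℓ a₋ a₊ m²₊ c β K` with r01's block size `K = Kmod` — EVERY scale `k ≧ 1` (`η = L^{−k}`), EVERY pair `Ω ⊂ Ω₀` of finite unions
  of `K`-blocks of `ηℤ^{d+1}`, EVERY vector field (regularity (1.7) on `Ω₀` is the member's hypothesis `regular`), the printed restriction
  `dist(·, Ω^c) ≧ R₀` imposed on every member (`rect := False`).
* **`prop21NN_torusPairFam`** — the same on `torusPairFam U d ℓ a₋ a₊ m²₊ c β K`: EVERY torus `T_η = Π_ν ℤ/(L^kP_ν)` (`K ∣ P_ν`), EVERY pair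
  `Ω ⊂ Ω₀ ⊂ T_η` of unions of `K`-blocks, EVERY torus vector field regular on `Ω₀`; the `R₀` restriction waived when `Ω = T_η` (the member's `rect`).
* `prop21NN_regionPairFam_exp` / `prop21NN_torusPairFam_exp` — the two statements for the PRINTED link variables (1.2) `U(t) = e^{tq}`, every
  antisymmetric `q` (flow hypothesis discharged by `expFlow_lipschitz`, `ℓ₁ = (Σ q_{ij}²)^{1/2}`).
* `prop21NN_regionPairFam_member` / `prop21NN_torusPairFam_member` — the clauses at one member, hypotheses spelled out.
* `regionPairFam_nonvacuous` / `torusPairFam_nonvacuous` — for the record: below every threshold `e₁` both families have members meeting all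
  four antecedents (r01's `hypotheses_met`), so the universally quantified clauses are not vacuous.
HONEST SCOPE.  (i) This is BOOKKEEPING ACROSS THE BRIDGE: the analysis is r01's (B4 sub-cell, (1.9)–(1.12) at a regular field by the random-walk
expansion of [Balaban1983RegularityDecay] §2 with Lemmata 2.1–2.2) and the bridge is p14's; no new estimate is proved here.  (ii) The families are
r01's readings of the printed objects: abelian one-parameter flow (1.2) (the print's generality), `N = |ι|` components, fields as component
functions `A_ν(x)` on the fine lattice / on the period box of the torus, the averaging contours `Γ^{(k)}_{y,x}` of (1.4) read as the single
staircase from the base corner of `B^k(y)` (`B4Lower18RegularRegion.rstairContour`; the print p. 572 only asks for «oriented contours in B^k(y)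
connecting the initial point y with a final point x»), distances in unit-lattice `ℓ^∞` units, `|·|` on `R^N` the Euclidean site norm; the
constants `δ₀ = (4K)^{−1}`, `R₀ = K(d+4) + 2`, `e₁`, `c₀(α)` are r01's (functions of `d, L, a₋, a₊, m²₊, c, β, ℓ₁` and `α`) — the print's
«depending on d, a, M only» is met in the sense that they do not depend on the member (A, k, Ω, Ω₀, the torus).  (iii) The (Higgs)₂,₃ CARRIER of
[Balaban1982Higgs1] (`HiggsLattice`/`HiggsCovariance.propagatorK`, averaging contours (2.11) = the composite contours `B1TorusCubeContours.gammaT`)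
is NOT a member of either family (different contour system inside the blocks, `d`- versus `(d+1)`-dimensional bookkeeping); its instances of
(2.24)/(2.25) at `A^{(K),ε}` on `T_ε` are the separate theorems of gens 8–10 quoted above, and its general-`Ω` instance is not claimed anywhere.
(iv) The literal leaf «∀ α < 1» (`B1.Prop21Printed`, negative `α` allowed) is NOT asserted; its range defect at `A = 0` is booked in
`B1Prop21ZeroField`.  Unit `lit-balaban-p35` gen 11 (literature-prover-lit-balaban-p35-g11-0).
-/

namespace Literature.MathematicalPhysics.QuantumFieldTheory.Balaban1983to89.B1Prop21RegularFieldFams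

open Literature.MathematicalPhysics.QuantumFieldTheory.Balaban1983to89.B1 (Ineq224_225 Ineq226)
open Literature.MathematicalPhysics.QuantumFieldTheory.Balaban1983to89.B1Prop21ZeroField (prop21NN_iff_thmPrintedNN)
open Literature.MathematicalPhysics.QuantumFieldTheory.Balaban1983to89.B4GaugeCovariance (OrthFlow)
open Literature.MathematicalPhysics.QuantumFieldTheory.Balaban1983to89.B4ThmRegionPairEta (RegionPairInst regionPairFam Kmod
  thmPrintedNN_regionPairFam)
open Literature.MathematicalPhysics.QuantumFieldTheory.Balaban1983to89.B4TorusPairFam (TorusPairInst torusPairFam)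
open Literature.MathematicalPhysics.QuantumFieldTheory.Balaban1983to89.B4ThmTorusPairEta (thmPrintedNN_torusPairFam)
open Literature.MathematicalPhysics.QuantumFieldTheory.Balaban1983to89.B4Eq12ExpFlow (expFlow expFlow_lipschitz)
open scoped Matrix

variable {ι : Type} [Fintype ι] [DecidableEq ι]

/-! ## §1 General pairs `Ω ⊂ Ω₀` of finite unions of big blocks in `ηℤ^{d+1}` (r01 gen 8's family) -/

/-- **PROP. 2.1, RULED READING `0 ≦ α < 1`, HOLDS AT A (2.23)/(1.7)-REGULAR FIELD ON THE FAMILY OF GENERAL PAIRS `Ω ⊂ Ω₀` OF FINITE UNIONS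
OF BIG BLOCKS**: for every orthogonal flow with `|(U(t) − 1)v|² ≦ (ℓ₁t)²|v|²`, `L = ℓ + 1 ≧ 2`, `0 < a₋`, `c ≧ 0`, `β > 0` and every `0 ≦ α < 1`
there are `δ₀, c₀, R₀, e₁ > 0` such that every member of `regionPairFam U d ℓ a₋ a₊ m²₊ c β Kmod` (scale `k ≧ 1`, pair `Ω ⊂ Ω₀ ⊂ ηℤ^{d+1}`,
field `A`, coupling `e`) whose field is regular on `Ω₀`, whose `Ω, Ω₀` are unions of `Kmod`-blocks and whose coupling is `0 < e ≦ e₁` satisfies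
(2.24)–(2.25) (`B1.Ineq224_225`: at `dist({x,x′}, Ω^c) ≧ R₀`, resp. `dist(x, Ω^c) ≧ R₀`) and (2.26) (`B1.Ineq226`) — p14's bridge
`prop21NN_iff_thmPrintedNN` applied to r01's `thmPrintedNN_regionPairFam`. [cite: Balaban1982Higgs1, Prop. 2.1 (2.23)–(2.26) pp.610–611] -/
theorem prop21NN_regionPairFam (U : OrthFlow ι) {ℓ₁ : ℝ} (hℓ₁ : 0 ≤ ℓ₁)
    (hLip : ∀ t (v : ι → ℝ), ((U.U t - 1) *ᵥ v) ⬝ᵥ ((U.U t - 1) *ᵥ v) ≤ (ℓ₁ * t) ^ 2 * (v ⬝ᵥ v))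
    (d ℓ : ℕ) (hℓ : 1 ≤ ℓ) (amin aplus m2plus : ℝ) (ha : 0 < amin) (creg β : ℝ) (hcreg : 0 ≤ creg) (hβ : 0 < β) :
    ∀ α : ℝ, 0 ≤ α → α < 1 → ∃ δ₀ c₀ R₀ e₁ : ℝ, 0 < δ₀ ∧ 0 < c₀ ∧ 0 < R₀ ∧ 0 < e₁ ∧
      ∀ i : RegionPairInst d ℓ amin aplus m2plus,
        (regionPairFam U d ℓ amin aplus m2plus creg β (Kmod U hℓ₁ hLip d ℓ hℓ amin aplus m2plus ha) i).regular →
        (regionPairFam U d ℓ amin aplus m2plus creg β (Kmod U hℓ₁ hLip d ℓ hℓ amin aplus m2plus ha) i).bigBlocks →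
        0 < (regionPairFam U d ℓ amin aplus m2plus creg β (Kmod U hℓ₁ hLip d ℓ hℓ amin aplus m2plus ha) i).e →
        (regionPairFam U d ℓ amin aplus m2plus creg β (Kmod U hℓ₁ hLip d ℓ hℓ amin aplus m2plus ha) i).e ≤ e₁ →
          Ineq224_225 (regionPairFam U d ℓ amin aplus m2plus creg β (Kmod U hℓ₁ hLip d ℓ hℓ amin aplus m2plus ha) i) α δ₀ c₀ R₀ ∧
          Ineq226 (regionPairFam U d ℓ amin aplus m2plus creg β (Kmod U hℓ₁ hLip d ℓ hℓ amin aplus m2plus ha) i) α δ₀ c₀ R₀ :=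
  (prop21NN_iff_thmPrintedNN _).2 (thmPrintedNN_regionPairFam U hℓ₁ hLip d ℓ hℓ amin aplus m2plus ha creg β hcreg hβ)

/-- **One member** of the lattice family, hypotheses spelled out: at scale `k`, for the pair of label sets `Ω_c ⊂ Ω₀,c` both unions of
`Kmod`-blocks, the field `A` with `|A_ν(x + e_μ) − A_ν(x)| ≦ c·e^{β−1}/L^k` on the fine region over `Ω₀,c` ((1.7) = (2.23) in lattice units) and
`0 < e ≦ e₁(α)`, the clauses (2.24)–(2.26) hold with the family's constants. [cite: Balaban1982Higgs1, Prop. 2.1 (2.24)–(2.26) pp.610–611] -/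
theorem prop21NN_regionPairFam_member (U : OrthFlow ι) {ℓ₁ : ℝ} (hℓ₁ : 0 ≤ ℓ₁)
    (hLip : ∀ t (v : ι → ℝ), ((U.U t - 1) *ᵥ v) ⬝ᵥ ((U.U t - 1) *ᵥ v) ≤ (ℓ₁ * t) ^ 2 * (v ⬝ᵥ v))
    (d ℓ : ℕ) (hℓ : 1 ≤ ℓ) (amin aplus m2plus : ℝ) (ha : 0 < amin) (creg β : ℝ) (hcreg : 0 ≤ creg) (hβ : 0 < β)
    {α : ℝ} (hα0 : 0 ≤ α) (hα1 : α < 1) :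
    ∃ δ₀ c₀ R₀ e₁ : ℝ, 0 < δ₀ ∧ 0 < c₀ ∧ 0 < R₀ ∧ 0 < e₁ ∧
      ∀ i : RegionPairInst d ℓ amin aplus m2plus,
        (regionPairFam U d ℓ amin aplus m2plus creg β (Kmod U hℓ₁ hLip d ℓ hℓ amin aplus m2plus ha) i).regular →
        (regionPairFam U d ℓ amin aplus m2plus creg β (Kmod U hℓ₁ hLip d ℓ hℓ amin aplus m2plus ha) i).bigBlocks →
        0 < i.e → i.e ≤ e₁ →
          Ineq224_225 (regionPairFam U d ℓ amin aplus m2plus creg β (Kmod U hℓ₁ hLip d ℓ hℓ amin aplus m2plus ha) i) α δ₀ c₀ R₀ ∧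
          Ineq226 (regionPairFam U d ℓ amin aplus m2plus creg β (Kmod U hℓ₁ hLip d ℓ hℓ amin aplus m2plus ha) i) α δ₀ c₀ R₀ :=
  prop21NN_regionPairFam U hℓ₁ hLip d ℓ hℓ amin aplus m2plus ha creg β hcreg hβ α hα0 hα1

/-- **The lattice statement for the PRINTED link variables (1.2) `U(A) = e^{qeηA}`**, every antisymmetric `N × N` matrix `q` (the flow
hypothesis discharged by r01's `expFlow_lipschitz` with `ℓ₁ = (Σ_{ij} q_{ij}²)^{1/2}`). [cite: Balaban1982Higgs1, Prop. 2.1 (2.23)–(2.26) pp.610–611] -/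
theorem prop21NN_regionPairFam_exp (q : Matrix ι ι ℝ) (hq : qᵀ = -q)
    (d ℓ : ℕ) (hℓ : 1 ≤ ℓ) (amin aplus m2plus : ℝ) (ha : 0 < amin) (creg β : ℝ) (hcreg : 0 ≤ creg) (hβ : 0 < β) :
    ∀ α : ℝ, 0 ≤ α → α < 1 → ∃ δ₀ c₀ R₀ e₁ : ℝ, 0 < δ₀ ∧ 0 < c₀ ∧ 0 < R₀ ∧ 0 < e₁ ∧
      ∀ i : RegionPairInst d ℓ amin aplus m2plus,
        (regionPairFam (expFlow q hq) d ℓ amin aplus m2plus creg β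
            (Kmod (expFlow q hq) (Real.sqrt_nonneg _) (expFlow_lipschitz q hq) d ℓ hℓ amin aplus m2plus ha) i).regular →
        (regionPairFam (expFlow q hq) d ℓ amin aplus m2plus creg β
            (Kmod (expFlow q hq) (Real.sqrt_nonneg _) (expFlow_lipschitz q hq) d ℓ hℓ amin aplus m2plus ha) i).bigBlocks →
        0 < i.e → i.e ≤ e₁ →
          Ineq224_225 (regionPairFam (expFlow q hq) d ℓ amin aplus m2plus creg β
            (Kmod (expFlow q hq) (Real.sqrt_nonneg _) (expFlow_lipschitz q hq) d ℓ hℓ amin aplus m2plus ha) i) α δ₀ c₀ R₀ ∧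
          Ineq226 (regionPairFam (expFlow q hq) d ℓ amin aplus m2plus creg β
            (Kmod (expFlow q hq) (Real.sqrt_nonneg _) (expFlow_lipschitz q hq) d ℓ hℓ amin aplus m2plus ha) i) α δ₀ c₀ R₀ :=
  prop21NN_regionPairFam (expFlow q hq) (Real.sqrt_nonneg _) (expFlow_lipschitz q hq) d ℓ hℓ amin aplus m2plus ha creg β
    hcreg hβ

/-- **Non-vacuity for the record**: below every threshold `e₁ > 0` the lattice family has members meeting all four antecedents (`regular`,
`bigBlocks`, `0 < e ≦ e₁`) — r01's `hypotheses_met` (e.g. `A = 0`, `Ω = Ω₀ =` one `Kmod`-cube at scale `k = 1`), so the clauses above are not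
vacuously quantified. [cite: Balaban1982Higgs1, Prop. 2.1 p.610] -/
theorem regionPairFam_nonvacuous (U : OrthFlow ι) {ℓ₁ : ℝ} (hℓ₁ : 0 ≤ ℓ₁)
    (hLip : ∀ t (v : ι → ℝ), ((U.U t - 1) *ᵥ v) ⬝ᵥ ((U.U t - 1) *ᵥ v) ≤ (ℓ₁ * t) ^ 2 * (v ⬝ᵥ v))
    (d ℓ : ℕ) (hℓ : 1 ≤ ℓ) {amin aplus m2plus : ℝ} (ha : 0 < amin) (hap : amin ≤ aplus) (hm : 0 ≤ m2plus)
    (creg β : ℝ) (hcreg : 0 ≤ creg) (e₁ : ℝ) (he₁ : 0 < e₁) :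
    ∃ i : RegionPairInst d ℓ amin aplus m2plus,
      (regionPairFam U d ℓ amin aplus m2plus creg β (Kmod U hℓ₁ hLip d ℓ hℓ amin aplus m2plus ha) i).regular ∧
      (regionPairFam U d ℓ amin aplus m2plus creg β (Kmod U hℓ₁ hLip d ℓ hℓ amin aplus m2plus ha) i).bigBlocks ∧
      0 < (regionPairFam U d ℓ amin aplus m2plus creg β (Kmod U hℓ₁ hLip d ℓ hℓ amin aplus m2plus ha) i).e ∧
      (regionPairFam U d ℓ amin aplus m2plus creg β (Kmod U hℓ₁ hLip d ℓ hℓ amin aplus m2plus ha) i).e ≤ e₁ :=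
  B4ThmRegionPairEta.hypotheses_met U d ℓ hap hm creg β hcreg _
    (le_trans (by norm_num) (Classical.choose_spec
      (B4ThmRegionPairEta.region_pair_members U hℓ₁ hLip d ℓ hℓ amin aplus m2plus ha)).1) e₁ he₁

/-! ## §2 Torus region pairs `Ω ⊂ Ω₀ ⊂ T_η` (r01 gen 9's family) -/

/-- **PROP. 2.1, RULED READING `0 ≦ α < 1`, HOLDS AT A (2.23)/(1.7)-REGULAR TORUS FIELD ON THE FAMILY OF TORUS REGION PAIRS
`Ω ⊂ Ω₀ ⊂ T_η`** («Another common case is to consider operators on subsets of a torus T_η … with periodic conditions»): for every orthogonal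
flow with `|(U(t) − 1)v|² ≦ (ℓ₁t)²|v|²`, `L = ℓ + 1 ≧ 2`, `0 < a₋`, `c ≧ 0`, `β > 0` and every `0 ≦ α < 1` there are `δ₀, c₀, R₀, e₁ > 0` such that
every member of `torusPairFam U d ℓ a₋ a₊ m²₊ c β Kmod` (torus `T_η = Π_ν ℤ/(L^kP_ν)`, pair `Ω ⊂ Ω₀ ⊂ T_η`, torus field `A`, coupling `e`) whose
field is regular on `Ω₀`, whose `Ω, Ω₀, T_η` are unions of `Kmod`-blocks and whose coupling is `0 < e ≦ e₁` satisfies (2.24)–(2.25)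
(`B1.Ineq224_225`, torus distances; no `R₀` restriction when `Ω = T_η`) and (2.26) (`B1.Ineq226`) — p14's bridge applied to r01's
`thmPrintedNN_torusPairFam`. [cite: Balaban1982Higgs1, Prop. 2.1 (2.23)–(2.26) pp.610–611] -/
theorem prop21NN_torusPairFam (U : OrthFlow ι) {ℓ₁ : ℝ} (hℓ₁ : 0 ≤ ℓ₁)
    (hLip : ∀ t (v : ι → ℝ), ((U.U t - 1) *ᵥ v) ⬝ᵥ ((U.U t - 1) *ᵥ v) ≤ (ℓ₁ * t) ^ 2 * (v ⬝ᵥ v))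
    (d ℓ : ℕ) (hℓ : 1 ≤ ℓ) (amin aplus m2plus : ℝ) (ha : 0 < amin) (creg β : ℝ) (hcreg : 0 ≤ creg) (hβ : 0 < β) :
    ∀ α : ℝ, 0 ≤ α → α < 1 → ∃ δ₀ c₀ R₀ e₁ : ℝ, 0 < δ₀ ∧ 0 < c₀ ∧ 0 < R₀ ∧ 0 < e₁ ∧
      ∀ i : TorusPairInst d ℓ amin aplus m2plus,
        (torusPairFam U d ℓ amin aplus m2plus creg β (Kmod U hℓ₁ hLip d ℓ hℓ amin aplus m2plus ha) i).regular →
        (torusPairFam U d ℓ amin aplus m2plus creg β (Kmod U hℓ₁ hLip d ℓ hℓ amin aplus m2plus ha) i).bigBlocks →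
        0 < (torusPairFam U d ℓ amin aplus m2plus creg β (Kmod U hℓ₁ hLip d ℓ hℓ amin aplus m2plus ha) i).e →
        (torusPairFam U d ℓ amin aplus m2plus creg β (Kmod U hℓ₁ hLip d ℓ hℓ amin aplus m2plus ha) i).e ≤ e₁ →
          Ineq224_225 (torusPairFam U d ℓ amin aplus m2plus creg β (Kmod U hℓ₁ hLip d ℓ hℓ amin aplus m2plus ha) i) α δ₀ c₀ R₀ ∧
          Ineq226 (torusPairFam U d ℓ amin aplus m2plus creg β (Kmod U hℓ₁ hLip d ℓ hℓ amin aplus m2plus ha) i) α δ₀ c₀ R₀ :=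
  (prop21NN_iff_thmPrintedNN _).2 (thmPrintedNN_torusPairFam U hℓ₁ hLip d ℓ hℓ amin aplus m2plus ha creg β hcreg hβ)

/-- **One member** of the torus family, hypotheses spelled out: on the torus with `P_ν` unit blocks per direction at scale `k`, for the pair
`Ω_T ⊂ Ω₀,T` of label sets (unions of `Kmod`-blocks, `Kmod ∣ P_ν`), the torus field `A` with
`|A_ν(x + e_μ mod T) − A_ν(x)| ≦ c·e^{β−1}/L^k` on the fine region over `Ω₀,T` and `0 < e ≦ e₁(α)`, the clauses (2.24)–(2.26) hold with the
family's constants. [cite: Balaban1982Higgs1, Prop. 2.1 (2.24)–(2.26) pp.610–611] -/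
theorem prop21NN_torusPairFam_member (U : OrthFlow ι) {ℓ₁ : ℝ} (hℓ₁ : 0 ≤ ℓ₁)
    (hLip : ∀ t (v : ι → ℝ), ((U.U t - 1) *ᵥ v) ⬝ᵥ ((U.U t - 1) *ᵥ v) ≤ (ℓ₁ * t) ^ 2 * (v ⬝ᵥ v))
    (d ℓ : ℕ) (hℓ : 1 ≤ ℓ) (amin aplus m2plus : ℝ) (ha : 0 < amin) (creg β : ℝ) (hcreg : 0 ≤ creg) (hβ : 0 < β)
    {α : ℝ} (hα0 : 0 ≤ α) (hα1 : α < 1) :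
    ∃ δ₀ c₀ R₀ e₁ : ℝ, 0 < δ₀ ∧ 0 < c₀ ∧ 0 < R₀ ∧ 0 < e₁ ∧
      ∀ i : TorusPairInst d ℓ amin aplus m2plus,
        (torusPairFam U d ℓ amin aplus m2plus creg β (Kmod U hℓ₁ hLip d ℓ hℓ amin aplus m2plus ha) i).regular →
        (torusPairFam U d ℓ amin aplus m2plus creg β (Kmod U hℓ₁ hLip d ℓ hℓ amin aplus m2plus ha) i).bigBlocks →
        0 < i.e → i.e ≤ e₁ →
          Ineq224_225 (torusPairFam U d ℓ amin aplus m2plus creg β (Kmod U hℓ₁ hLip d ℓ hℓ amin aplus m2plus ha) i) α δ₀ c₀ R₀ ∧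
          Ineq226 (torusPairFam U d ℓ amin aplus m2plus creg β (Kmod U hℓ₁ hLip d ℓ hℓ amin aplus m2plus ha) i) α δ₀ c₀ R₀ :=
  prop21NN_torusPairFam U hℓ₁ hLip d ℓ hℓ amin aplus m2plus ha creg β hcreg hβ α hα0 hα1

/-- **The torus statement for the PRINTED link variables (1.2) `U(A) = e^{qeηA}`**, every antisymmetric `N × N` matrix `q`.
[cite: Balaban1982Higgs1, Prop. 2.1 (2.23)–(2.26) pp.610–611] -/
theorem prop21NN_torusPairFam_exp (q : Matrix ι ι ℝ) (hq : qᵀ = -q)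
    (d ℓ : ℕ) (hℓ : 1 ≤ ℓ) (amin aplus m2plus : ℝ) (ha : 0 < amin) (creg β : ℝ) (hcreg : 0 ≤ creg) (hβ : 0 < β) :
    ∀ α : ℝ, 0 ≤ α → α < 1 → ∃ δ₀ c₀ R₀ e₁ : ℝ, 0 < δ₀ ∧ 0 < c₀ ∧ 0 < R₀ ∧ 0 < e₁ ∧
      ∀ i : TorusPairInst d ℓ amin aplus m2plus,
        (torusPairFam (expFlow q hq) d ℓ amin aplus m2plus creg β
            (Kmod (expFlow q hq) (Real.sqrt_nonneg _) (expFlow_lipschitz q hq) d ℓ hℓ amin aplus m2plus ha) i).regular →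
        (torusPairFam (expFlow q hq) d ℓ amin aplus m2plus creg β
            (Kmod (expFlow q hq) (Real.sqrt_nonneg _) (expFlow_lipschitz q hq) d ℓ hℓ amin aplus m2plus ha) i).bigBlocks →
        0 < i.e → i.e ≤ e₁ →
          Ineq224_225 (torusPairFam (expFlow q hq) d ℓ amin aplus m2plus creg β
            (Kmod (expFlow q hq) (Real.sqrt_nonneg _) (expFlow_lipschitz q hq) d ℓ hℓ amin aplus m2plus ha) i) α δ₀ c₀ R₀ ∧
          Ineq226 (torusPairFam (expFlow q hq) d ℓ amin aplus m2plus creg β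
            (Kmod (expFlow q hq) (Real.sqrt_nonneg _) (expFlow_lipschitz q hq) d ℓ hℓ amin aplus m2plus ha) i) α δ₀ c₀ R₀ :=
  prop21NN_torusPairFam (expFlow q hq) (Real.sqrt_nonneg _) (expFlow_lipschitz q hq) d ℓ hℓ amin aplus m2plus ha creg β
    hcreg hβ

/-- **Non-vacuity for the record** (torus family): below every threshold `e₁ > 0` there are members meeting `regular`, `bigBlocks`,
`0 < e ≦ e₁` — r01's `B4ThmTorusPairEta.hypotheses_met` (e.g. `A = 0`, `Ω = Ω₀ =` one `Kmod`-cube on the torus of `3·Kmod` unit blocks per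
direction at scale `k = 1`). [cite: Balaban1982Higgs1, Prop. 2.1 p.610] -/
theorem torusPairFam_nonvacuous (U : OrthFlow ι) {ℓ₁ : ℝ} (hℓ₁ : 0 ≤ ℓ₁)
    (hLip : ∀ t (v : ι → ℝ), ((U.U t - 1) *ᵥ v) ⬝ᵥ ((U.U t - 1) *ᵥ v) ≤ (ℓ₁ * t) ^ 2 * (v ⬝ᵥ v))
    (d ℓ : ℕ) (hℓ : 1 ≤ ℓ) {amin aplus m2plus : ℝ} (ha : 0 < amin) (hap : amin ≤ aplus) (hm : 0 ≤ m2plus)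
    (creg β : ℝ) (hcreg : 0 ≤ creg) (e₁ : ℝ) (he₁ : 0 < e₁) :
    ∃ i : TorusPairInst d ℓ amin aplus m2plus,
      (torusPairFam U d ℓ amin aplus m2plus creg β (Kmod U hℓ₁ hLip d ℓ hℓ amin aplus m2plus ha) i).regular ∧
      (torusPairFam U d ℓ amin aplus m2plus creg β (Kmod U hℓ₁ hLip d ℓ hℓ amin aplus m2plus ha) i).bigBlocks ∧
      0 < (torusPairFam U d ℓ amin aplus m2plus creg β (Kmod U hℓ₁ hLip d ℓ hℓ amin aplus m2plus ha) i).e ∧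
      (torusPairFam U d ℓ amin aplus m2plus creg β (Kmod U hℓ₁ hLip d ℓ hℓ amin aplus m2plus ha) i).e ≤ e₁ :=
  B4ThmTorusPairEta.hypotheses_met U d ℓ hap hm creg β hcreg _
    (le_trans (by norm_num) (Classical.choose_spec
      (B4ThmRegionPairEta.region_pair_members U hℓ₁ hLip d ℓ hℓ amin aplus m2plus ha)).1) e₁ he₁

/-- Sanity instance for the record: the complex scalar (abelian Higgs) case `N = 2`, rotation flow `U(t) = e^{tq}`, `q = [[0,−1],[1,0]]`
(`B4GaugeCovariance.OrthFlow.rot`, flow hypothesis `B4Lower18Regular.rot_lipschitz` with `ℓ₁ = 1`), `d + 1 = 3`, `L = 3`, `a₋ = a₊ = 1`,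
`m²₊ = 0`, `c = 1`, `β = 1/2`, `α = 1/2`, on the torus family. [cite: Balaban1982Higgs1, Prop. 2.1 p.610] -/
example : ∃ δ₀ c₀ R₀ e₁ : ℝ, 0 < δ₀ ∧ 0 < c₀ ∧ 0 < R₀ ∧ 0 < e₁ ∧
    ∀ i : TorusPairInst 2 2 1 1 0,
      (torusPairFam OrthFlow.rot 2 2 1 1 0 1 (1 / 2)
          (Kmod OrthFlow.rot zero_le_one B4Lower18Regular.rot_lipschitz 2 2 (by norm_num) 1 1 0 one_pos) i).regular →
      (torusPairFam OrthFlow.rot 2 2 1 1 0 1 (1 / 2)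
          (Kmod OrthFlow.rot zero_le_one B4Lower18Regular.rot_lipschitz 2 2 (by norm_num) 1 1 0 one_pos) i).bigBlocks →
      0 < i.e → i.e ≤ e₁ →
        Ineq224_225 (torusPairFam OrthFlow.rot 2 2 1 1 0 1 (1 / 2)
          (Kmod OrthFlow.rot zero_le_one B4Lower18Regular.rot_lipschitz 2 2 (by norm_num) 1 1 0 one_pos) i) (1 / 2) δ₀ c₀ R₀ ∧
        Ineq226 (torusPairFam OrthFlow.rot 2 2 1 1 0 1 (1 / 2)
          (Kmod OrthFlow.rot zero_le_one B4Lower18Regular.rot_lipschitz 2 2 (by norm_num) 1 1 0 one_pos) i) (1 / 2) δ₀ c₀ R₀ :=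
  prop21NN_torusPairFam_member OrthFlow.rot zero_le_one B4Lower18Regular.rot_lipschitz 2 2 (by norm_num) 1 1 0 one_pos 1 (1 / 2)
    zero_le_one (by norm_num) (by norm_num) (by norm_num)

end Literature.MathematicalPhysics.QuantumFieldTheory.Balaban1983to89.B1Prop21RegularFieldFams
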